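import Mathlib
import Literature.Probability.LatticeModels.ClusterExpansion

/-!
# Beta / MarkedResummation344 — BINDER-OWNERS row D4, co-owner road P2′: the MARKED-POLYMER quotient identity
# [Balaban1988Convergent] (3.44)–(3.46) pp. 277–278 and its Kotecký–Preiss bound, in ABSTRACT KERNEL FORM (by name from the
# tree's polymer-gas / cluster-expansion library)
# (β sub-cell, unit `b2b-balaban-beta-d4-p2`, generation 1; NODE R (leaves R.1, R.2-global) of `HOME/beta/skeletons/D4-b2b-balaban-beta-d4-p2.md`)

HONEST FRAMING (page 1 of everything the β sub-cell writes): discharging `BetaPertH` makes Bałaban's UV stability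
UNCONDITIONAL — a real constructive-QFT result; it is NOT the continuum limit and NOT the Clay problem.  HONEST DEPENDENCY
(cell reorg 2026-08-19, verbatim): «continuum YM on T⁴ ⇐ BetaPertH ∧ nine spine estimates (0/9 proved); BetaPertH ⇐ (D1) ∧
(D4) ∧ CAP+tail; G-an2-4 gates asym, D1 and NE2/3/4.»  THIS MODULE INSTANTIATES NO BINDER AND ASSERTS NOTHING ABOUT
BAŁABAN'S ACTIVITIES: it is finite combinatorics of an ABSTRACT hard-core polymer gas (any type `P` of polymers, any
reflexive symmetric incompatibility `inc`, any complex activities), every theorem proved from the UNMODIFIED tree modules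
`Literature.Probability.LatticeModels.PolymerGas` / `.ClusterExpansion` (the Kotecký–Preiss machinery PROVED there:
`polymerPartitionFunction_insert`, `polymerPartitionFunction_sdiff_div_eq_exp`,
`norm_polymerPartitionFunction_sdiff_div_le_of_kp`, `sum_kpTerm_le_sum_of_incompatible`) imported BY NAME.

ABSOLUTE RULE (cell charter, verbatim): "No internally-minted statement may enter as a cited fact. Every hypothesis is
either kernel-proved in this package or a verbatim quotation of a PUBLISHED theorem with page reference. The manuscript(s)
under audit are NOT citable for their own disputed steps — they are the thing under adjudication; programme-internal
(2001/route/tribunal) claims are never citable."  Nothing is cited as a fact here; [KoteckyPreiss1986] enters as a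
tree THEOREM.

## The printed text ([III] = [Balaban1988Convergent], CMP 119, pp. 277–278 [PDF 35–36]; renders p035/p036 READ AS IMAGES)

(3.44) *«[the nominator of the expectation value in (3.37)] = Σ_{{Z₀,…,Z_n}} H′(Z₀)·…·H(Z_n), (3.44) where the
localization domains Z₀,…,Z_n satisfy all the conditions described in Sect. 7 [I] in connection with the formula (7.11),
and the above conditions too. In addition the domain Z₀ contains the bond b (or the point z). We can have n = 0, for
n > 0 the factors H(Z_i) are the same as in the expansion of the denominator. The factor H′(Z₀) is different; it is given
by an integral with the integrand including, as one of the factors, a localized term from the expansion of the integrated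
function in the expectation value in (3.37). Although different, it satisfies the same bound as the other factors. In the
sum (3.44) we separate the summation over Z₀, and for a fixed Z₀ we consider the remaining sum over {Z₁,…,Z_n}. It has
the form (I.7.11), with the additional condition that the domains Z_i do not intersect Z₀ along a cube, or a wall of a
cube. … The sum is exponentiated, … and we have
   [the expectation value in (3.37)] = Σ_{Z₀∋b} H′(Z₀) exp[Ẽ^{(k+1)}(Λ_{k+1}, Z̄₀ᶜ) − Ẽ^{(k+1)}(Λ_{k+1})]. (3.45)
The difference in the exponential has the representation (I.7.12) with (Z₁,…,Z_n) satisfying the additional condition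
that at least one of the localization domains intersects Z₀ along a three-dimensional wall at least.»* ((3.46): the same
resummed by localization domains; (3.47): the Mayer expansion of the exponential — NOT typed here, see below.)

## What is typed (abstract polymer gas: `P` polymers, `inc` = «intersect along a cube or a wall of a cube», reflexive
and symmetric; `w` = the activities H(Z) of the denominator on the finite catalogue `Λ`; `w′` = the marked activities
H′(Z₀), on the marked polymers `Mk ⊆ Λ` = those containing the bond b)

* §1 `compatWith Λ Z₀` = the polymers of `Λ` compatible with `Z₀` (= [III]'s «do not intersect Z₀ along a cube, or a wall
  of a cube», the catalogue of `Ẽ(Λ, Z̄₀ᶜ)`); `markedNumerator` = Σ_{Z₀∈Mk} w′(Z₀)·Ξ(w, compatWith Λ Z₀);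
  `markedNumerator_eq_sum_families` — R.1, THIS IS (3.44) «we separate the summation over Z₀»: the marked numerator equals
  the sum over the compatible families `{Z₀} ∪ A` with exactly one distinguished marked member of `w′(Z₀)·Π_{A} w`.
* §2 `markedExpect` = `markedNumerator / Ξ(w, Λ)`; `markedExpect_eq_sum_exp` — (3.45)/(3.46): under the Kotecký–Preiss
  condition on `Λ`, `⟨·⟩ = Σ_{Z₀∈Mk} w′(Z₀)·exp(−Σ_{C ⊆ Λ, C meets the polymers incompatible with Z₀} Φ^T(C))` — the
  exponent is exactly «the clusters at least one of whose members intersects Z₀ along a wall» (tree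
  `polymerPartitionFunction_sdiff_div_eq_exp`, [KoteckyPreiss1986] PROVED in the tree).
* §3 `norm_markedExpect_le` — R.2 (GLOBAL form): `‖⟨·⟩‖ ≤ Σ_{Z₀∈Mk} ‖w′(Z₀)‖·e^{a(Z₀)}` (tree
  `norm_polymerPartitionFunction_sdiff_div_le_of_kp` + `sum_kpTerm_le_sum_of_incompatible`): the marked activity's bound
  times the KP size factor, summed over the marked polymers — with road P1's geometric leaves ((1.26)-type anchor sum at the
  cube of b, `B13FamilySum.Ineq126`; volume bound `VolBound`) this is `≤ (sup bound of H′)·K₀·e^{τc₁}` as on p. 278.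
NOT typed here (remaining swarm leaf R.3 of the skeleton): the LOCALIZED form (3.47) — the Mayer expansion of the
exponential of (3.45) resummed by localization domain X ∋ b with tree decay `e^{−κ d_{k+1}(X)}` (needs the anchored
second resummation with (2.27)/(1.26), as in `B13Resummation.norm_locE_le`).  NOT CLAIMED: anything about Bałaban's
H, H′ (hypothesis-free abstract statements only); NOT BetaPertH, NOT continuum, NOT Clay.
-/

namespace Summit.QuantumFields.BalabanUV.Beta.MarkedResummation344

open Finset
open Literature.Probability.LatticeModels

noncomputable section

variable {P : Type*} [DecidableEq P] {inc : P → P → Prop} [DecidableRel inc]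

/-! ## §1 The marked numerator and (3.44)'s «separate the summation over Z₀» -/

/-- The polymers of the catalogue `Λ` COMPATIBLE with a given polymer `Z₀` ([III] p. 278: «the domains Z_i do not
intersect Z₀ along a cube, or a wall of a cube», i.e. the catalogue `Z̄₀ᶜ` of `Ẽ^{(k+1)}(Λ_{k+1}, Z̄₀ᶜ)`).  For a reflexive
`inc`, `Z₀` itself is excluded. -/
def compatWith (inc : P → P → Prop) [DecidableRel inc] (Λ : Finset P) (Z₀ : P) : Finset P :=
  Λ.filter fun Z => ¬ inc Z₀ Z

/-- The polymers of `Λ` INCOMPATIBLE with `Z₀` (those meeting Z₀ along a wall; contains Z₀ for reflexive `inc`). -/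
def incompatWith (inc : P → P → Prop) [DecidableRel inc] (Λ : Finset P) (Z₀ : P) : Finset P :=
  Λ.filter fun Z => inc Z₀ Z

/-- `compatWith` is the complement of `incompatWith` in `Λ`. -/
theorem compatWith_eq_sdiff (Λ : Finset P) (Z₀ : P) : compatWith inc Λ Z₀ = Λ \ incompatWith inc Λ Z₀ := by
  ext Z
  simp only [compatWith, incompatWith, mem_filter, mem_sdiff]
  tauto

omit [DecidableEq P] in
/-- `compatWith Λ Z₀ ⊆ Λ`. -/
theorem compatWith_subset (Λ : Finset P) (Z₀ : P) : compatWith inc Λ Z₀ ⊆ Λ := filter_subset _ _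

omit [DecidableEq P] in
/-- `incompatWith Λ Z₀ ⊆ Λ`. -/
theorem incompatWith_subset (Λ : Finset P) (Z₀ : P) : incompatWith inc Λ Z₀ ⊆ Λ := filter_subset _ _

omit [DecidableEq P] in
/-- For reflexive `inc`, `Z₀ ∉ compatWith Λ Z₀`. -/
theorem not_mem_compatWith [Std.Refl inc] (Λ : Finset P) (Z₀ : P) : Z₀ ∉ compatWith inc Λ Z₀ := by
  simp [compatWith, Std.Refl.refl (r := inc) Z₀]

/-- **THE MARKED NUMERATOR** in the «summation over Z₀ separated» form of [III] p. 278: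
`Σ_{Z₀ ∈ Mk} w′(Z₀) · Ξ(w, compatWith Λ Z₀)`. -/
def markedNumerator (inc : P → P → Prop) [DecidableRel inc] (w w' : P → ℂ) (Λ Mk : Finset P) : ℂ :=
  ∑ Z₀ ∈ Mk, w' Z₀ * polymerPartitionFunction inc w (compatWith inc Λ Z₀)

/-- The index sets agree: subfamilies `A` of `compatWith Λ Z₀` that are compatible ⟷ subfamilies `A` of `Λ.erase Z₀`
such that `{Z₀} ∪ A` is compatible (reflexive symmetric `inc`). -/
theorem filter_powerset_compatWith_eq [Std.Refl inc] [Std.Symm inc] (Λ : Finset P) (Z₀ : P) :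
    (compatWith inc Λ Z₀).powerset.filter (fun A => IsCompatible inc A) =
      (Λ.erase Z₀).powerset.filter (fun A => IsCompatible inc (insert Z₀ A)) := by
  have hsymm : ∀ γ γ' : P, inc γ γ' → inc γ' γ := fun γ γ' h => Std.Symm.symm γ γ' h
  ext A
  simp only [mem_filter, mem_powerset]
  constructor
  · rintro ⟨hA, hcomp⟩
    have hA' : ∀ Z ∈ A, Z ∈ Λ ∧ ¬ inc Z₀ Z := fun Z hZ => by
      have := hA hZ; simpa [compatWith, mem_filter] using this
    have hZ₀ : Z₀ ∉ A := fun h => not_mem_compatWith (inc := inc) Λ Z₀ (hA h)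
    refine ⟨fun Z hZ => mem_erase.2 ⟨fun h => hZ₀ (h ▸ hZ), (hA' Z hZ).1⟩, ?_⟩
    exact (isCompatible_insert hsymm hZ₀).2 ⟨hcomp, fun Z hZ => (hA' Z hZ).2⟩
  · rintro ⟨hA, hcomp⟩
    have hZ₀ : Z₀ ∉ A := fun h => (mem_erase.1 (hA h)).1 rfl
    obtain ⟨hcompA, hno⟩ := (isCompatible_insert hsymm hZ₀).1 hcomp
    refine ⟨fun Z hZ => ?_, hcompA⟩
    simp only [compatWith, mem_filter]
    exact ⟨(mem_erase.1 (hA hZ)).2, hno Z hZ⟩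

/-- **R.1 = [III] (3.44), «we separate the summation over Z₀»**: the marked numerator IS the sum, over the marked polymer
`Z₀ ∈ Mk` and the families `A ⊆ Λ ∖ {Z₀}` with `{Z₀} ∪ A` compatible, of `w′(Z₀)·Π_{Z∈A} w(Z)` — one distinguished
marked factor H′(Z₀), «for n > 0 the factors H(Z_i) are the same as in the expansion of the denominator». -/
theorem markedNumerator_eq_sum_families [Std.Refl inc] [Std.Symm inc] (w w' : P → ℂ) (Λ Mk : Finset P) :
    markedNumerator inc w w' Λ Mk =
      ∑ Z₀ ∈ Mk, ∑ A ∈ (Λ.erase Z₀).powerset with IsCompatible inc (insert Z₀ A), w' Z₀ * ∏ Z ∈ A, w Z := by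
  unfold markedNumerator
  refine sum_congr rfl fun Z₀ _ => ?_
  rw [polymerPartitionFunction_eq_sum_filter, filter_powerset_compatWith_eq, mul_sum]

/-! ## §2 The marked expectation and (3.45)/(3.46): exponentiation by Kotecký–Preiss -/

/-- **THE MARKED EXPECTATION** `⟨F_b⟩ = markedNumerator / Ξ(w, Λ)` ([III] (3.37)'s expectation value after the
expansions (3.44) of numerator and denominator). -/
def markedExpect (inc : P → P → Prop) [DecidableRel inc] (w w' : P → ℂ) (Λ Mk : Finset P) : ℂ :=
  markedNumerator inc w w' Λ Mk / polymerPartitionFunction inc w Λ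

/-- `⟨F_b⟩ = Σ_{Z₀∈Mk} w′(Z₀) · (Ξ(w, Λ ∖ incompatWith Λ Z₀) / Ξ(w, Λ))` — (3.45) before exponentiation. -/
theorem markedExpect_eq_sum_div (w w' : P → ℂ) (Λ Mk : Finset P) :
    markedExpect inc w w' Λ Mk =
      ∑ Z₀ ∈ Mk, w' Z₀ * (polymerPartitionFunction inc w (Λ \ incompatWith inc Λ Z₀) /
        polymerPartitionFunction inc w Λ) := by
  unfold markedExpect markedNumerator
  rw [sum_div]
  refine sum_congr rfl fun Z₀ _ => ?_
  rw [compatWith_eq_sdiff, mul_div_assoc]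

/-- **(3.45)/(3.46) = [III] p. 278 IN ABSTRACT FORM.**  If the catalogue `Λ` is a Kotecký–Preiss volume for the
unmarked activities (size function `a`), then
`⟨F_b⟩ = Σ_{Z₀∈Mk} w′(Z₀) · exp(− Σ_{C ⊆ Λ : C meets incompatWith Λ Z₀} Φ^T(C; w))`
— the exponent being the truncated functionals of EXACTLY the clusters «at least one of whose localization domains
intersects Z₀ along a three-dimensional wall at least» (`polymerPartitionFunction_sdiff_div_eq_exp`, from
[KoteckyPreiss1986] Theorem p. 492 as PROVED in the tree). -/
theorem markedExpect_eq_sum_exp [Std.Refl inc] [Std.Symm inc] {w : P → ℂ} {a : P → ℝ} {Λ : Finset P}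
    (hKP : IsKPVolume inc w a Λ) (w' : P → ℂ) (Mk : Finset P) :
    markedExpect inc w w' Λ Mk =
      ∑ Z₀ ∈ Mk, w' Z₀ * Complex.exp (-∑ C ∈ Λ.powerset with (C ∩ incompatWith inc Λ Z₀).Nonempty,
        truncatedWeight inc w C) := by
  rw [markedExpect_eq_sum_div]
  refine sum_congr rfl fun Z₀ _ => ?_
  rw [polymerPartitionFunction_sdiff_div_eq_exp hKP]

/-! ## §3 R.2 (global form): the Kotecký–Preiss bound on the marked expectation -/

omit [DecidableEq P] in
/-- Every polymer incompatible with `Z₀` is incompatible with SOME member of `{Z₀}` (bookkeeping for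
`sum_kpTerm_le_sum_of_incompatible`). -/
theorem incompatWith_witness [Std.Symm inc] (Λ : Finset P) (Z₀ : P) :
    ∀ γ' ∈ incompatWith inc Λ Z₀, ∃ γ ∈ ({Z₀} : Finset P), inc γ' γ := by
  intro γ' hγ'
  refine ⟨Z₀, mem_singleton_self _, ?_⟩
  exact Std.Symm.symm _ _ (mem_filter.1 hγ').2

/-- **The one-marked-polymer ratio bound**: for `Z₀ ∈ Λ`, `‖Ξ(w, Λ ∖ incompatWith Λ Z₀) / Ξ(w, Λ)‖ ≤ e^{a(Z₀)}` —
removing the polymers touching Z₀ costs at most the KP size of Z₀ (`norm_polymerPartitionFunction_sdiff_div_le_of_kp` +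
`sum_kpTerm_le_sum_of_incompatible` with `Δ = {Z₀}`). -/
theorem norm_ratio_le_exp [Std.Refl inc] [Std.Symm inc] {w : P → ℂ} {a : P → ℝ} {Λ : Finset P}
    (hKP : IsKPVolume inc w a Λ) {Z₀ : P} (hZ₀ : Z₀ ∈ Λ) :
    ‖polymerPartitionFunction inc w (Λ \ incompatWith inc Λ Z₀) / polymerPartitionFunction inc w Λ‖ ≤
      Real.exp (a Z₀) := by
  have h1 := norm_polymerPartitionFunction_sdiff_div_le_of_kp hKP (Finset.Subset.refl Λ)
    (incompatWith_subset (inc := inc) Λ Z₀)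
  have h2 := sum_kpTerm_le_sum_of_incompatible hKP (incompatWith_subset (inc := inc) Λ Z₀)
    (singleton_subset_iff.2 hZ₀) (incompatWith_witness (inc := inc) Λ Z₀)
  rw [sum_singleton] at h2
  exact h1.trans (Real.exp_le_exp.2 h2)

/-- **R.2 (GLOBAL FORM) — the marked expectation is bounded by the KP-weighted marked activities**:
`‖⟨F_b⟩‖ ≤ Σ_{Z₀∈Mk} ‖w′(Z₀)‖·e^{a(Z₀)}` for `Mk ⊆ Λ` a KP volume.  With a marked-activity bound
`‖w′(Z₀)‖ ≤ ins·C₃′·e^{−R d_{k+1}(Z₀)}` (skeleton A′.2), `a(Z₀) = τ·#cubes(Z₀) ≤ τc₁(1 + d_{k+1}(Z₀))` (road P1's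
`VolBound`) and the anchor sum `Σ_{Z₀ ∋ b} e^{−κ₀ d_{k+1}(Z₀)} ≤ K₀` ((1.26), `Ineq126`), this is
`≤ ins·C₃′·e^{τc₁}·K₀` once `R ≥ κ₀ + τc₁` — the p. 278 bound of the third term of (3.37) before localization. -/
theorem norm_markedExpect_le [Std.Refl inc] [Std.Symm inc] {w : P → ℂ} {a : P → ℝ} {Λ : Finset P}
    (hKP : IsKPVolume inc w a Λ) (w' : P → ℂ) {Mk : Finset P} (hMk : Mk ⊆ Λ) :
    ‖markedExpect inc w w' Λ Mk‖ ≤ ∑ Z₀ ∈ Mk, ‖w' Z₀‖ * Real.exp (a Z₀) := by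
  rw [markedExpect_eq_sum_div]
  refine (norm_sum_le _ _).trans (sum_le_sum fun Z₀ hZ₀ => ?_)
  rw [norm_mul]
  exact mul_le_mul_of_nonneg_left (norm_ratio_le_exp hKP (hMk hZ₀)) (norm_nonneg _)

/-- The same with a uniform-shape marked bound: if `‖w′(Z₀)‖ ≤ m·u(Z₀)` on `Mk` (m = the insertion's sup, u the
unmarked activity majorant), then `‖⟨F_b⟩‖ ≤ m · Σ_{Z₀∈Mk} u(Z₀)·e^{a(Z₀)}` — «Although different, it satisfies the same
bound as the other factors» turned into arithmetic. -/
theorem norm_markedExpect_le_of_bound [Std.Refl inc] [Std.Symm inc] {w : P → ℂ} {a : P → ℝ} {Λ : Finset P}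
    (hKP : IsKPVolume inc w a Λ) {w' : P → ℂ} {Mk : Finset P} (hMk : Mk ⊆ Λ) {m : ℝ} {u : P → ℝ}
    (hw' : ∀ Z₀ ∈ Mk, ‖w' Z₀‖ ≤ m * u Z₀) :
    ‖markedExpect inc w w' Λ Mk‖ ≤ m * ∑ Z₀ ∈ Mk, u Z₀ * Real.exp (a Z₀) := by
  refine (norm_markedExpect_le hKP w' hMk).trans ?_
  rw [mul_sum]
  refine sum_le_sum fun Z₀ hZ₀ => ?_
  have := mul_le_mul_of_nonneg_right (hw' Z₀ hZ₀) (Real.exp_pos (a Z₀)).le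
  linarith [this]

end

end Summit.QuantumFields.BalabanUV.Beta.MarkedResummation344
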